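import Literature.Probability.Distributions.BrascampLiebMarginal
import Literature.Probability.Distributions.BrascampLiebDimOne
import HarnessLib

/-!
# Strictly convex potentials grow linearly: `∫ e^{-f} < ∞`

`Literature/Probability/Distributions/`. The first assertion of Brascamp–Lieb 1976, Theorem 4.1:
"Let `f` have a minimum, so that `F = e^{-f}` decreases exponentially in all directions; then
`∫ F dx < ∞`." For `f ∈ C²(ℝⁿ)` with positive definite Hessian attaining its minimum at `a`:

* `f x > f a` for `x ≠ a` (restrict to the line through `a` and `x` and use the one-dimensional
  facts of `BrascampLiebDimOne`);
* with `δ = min_{‖x-a‖=1} (f x - f a) > 0`, convexity along lines gives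
  `f x ≥ f a + δ‖x - a‖ - δ`, hence `f x ≥ δ‖x‖ - C₀` (`exists_linear_lower_bound`);
* consequently `e^{-f}` is integrable (`integrable_exp_neg_of_posDef`).

Theorems only. References: H. J. Brascamp, E. H. Lieb, J. Funct. Anal. 22 (1976) 366–389,
Thm 4.1 (statement, p. 375). [BrascampLieb1976]
-/

noncomputable section

open MeasureTheory Filter Set Metric
open scoped ENNReal Topology

namespace Literature.Probability.Distributions

namespace BrascampLiebConvex

open BrascampLiebCalculus BrascampLiebMarginal

variable {m : ℕ} {f : (Fin m → ℝ) → ℝ} {a : Fin m → ℝ}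

/-- Along a line through the minimum `a` in a direction `v ≠ 0`, the restriction
`φ(t) = f(a + t v)` of a `C²` function with positive definite Hessian has `φ' > 0` for `t > 0`
and `φ` is convex on `ℝ`. [folklore] -/
theorem line_facts (hf : ContDiff ℝ 2 f) (hpd : ∀ x, (coordHessian f x).PosDef)
    (ha : ∀ x, f a ≤ f x) {v : Fin m → ℝ} (hv : v ≠ 0) :
    (∀ t : ℝ, 0 < t → 0 < fderiv ℝ f (a + t • v) v) ∧
    ConvexOn ℝ univ (fun t : ℝ => f (a + t • v)) := by
  have hd : Differentiable ℝ f := hf.differentiable two_ne_zero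
  have h1 : ∀ t, HasDerivAt (fun s : ℝ => f (a + s • v)) (fderiv ℝ f (a + t • v) v) t :=
    fun t => hasDerivAt_line hd a v t
  have h2 : ∀ t, HasDerivAt (fun s : ℝ => fderiv ℝ f (a + s • v) v)
      (fderiv ℝ (fderiv ℝ f) (a + t • v) v v) t := fun t => hasDerivAt_line_fderiv hf a v t
  have hpos : ∀ t : ℝ, 0 < fderiv ℝ (fderiv ℝ f) (a + t • v) v v := fun t =>
    (posDef_coordHessian_iff hf _).1 (hpd _) v hv
  have hmin : ∀ t : ℝ, f (a + (0 : ℝ) • v) ≤ f (a + t • v) := fun t => by simpa using ha (a + t • v)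
  refine ⟨fun t ht => BrascampLiebDimOne.deriv_pos_of_gt (f := fun s : ℝ => f (a + s • v))
    (f' := fun s => fderiv ℝ f (a + s • v) v) (f'' := fun s => fderiv ℝ (fderiv ℝ f) (a + s • v) v v)
    h1 h2 hpos hmin ht, ?_⟩
  have hmono : StrictMono fun s : ℝ => fderiv ℝ f (a + s • v) v :=
    strictMono_of_hasDerivAt_pos h2 hpos
  refine MonotoneOn.convexOn_of_deriv convex_univ
    (continuous_iff_continuousAt.2 fun t => (h1 t).continuousAt).continuousOn
    (fun t _ => (h1 t).differentiableAt.differentiableWithinAt) ?_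
  intro s _ t _ hst
  rw [(h1 s).deriv, (h1 t).deriv]
  exact hmono.monotone hst

/-- **Strict minimum**: `f x > f a` for `x ≠ a`. [folklore] -/
theorem lt_of_ne (hf : ContDiff ℝ 2 f) (hpd : ∀ x, (coordHessian f x).PosDef)
    (ha : ∀ x, f a ≤ f x) {x : Fin m → ℝ} (hx : x ≠ a) : f a < f x := by
  have hv : x - a ≠ 0 := sub_ne_zero.2 hx
  obtain ⟨hpos, -⟩ := line_facts hf hpd ha hv
  have hd : Differentiable ℝ f := hf.differentiable two_ne_zero
  have h1 : ∀ t, HasDerivAt (fun s : ℝ => f (a + s • (x - a))) (fderiv ℝ f (a + t • (x - a)) (x - a)) t :=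
    fun t => hasDerivAt_line hd a (x - a) t
  have hsm : StrictMonoOn (fun s : ℝ => f (a + s • (x - a))) (Set.Ici 0) := by
    refine strictMonoOn_of_deriv_pos (convex_Ici 0)
      (continuous_iff_continuousAt.2 fun t => (h1 t).continuousAt).continuousOn fun t ht => ?_
    rw [interior_Ici] at ht
    rw [(h1 t).deriv]
    exact hpos t ht
  have := hsm Set.self_mem_Ici (show (1 : ℝ) ∈ Set.Ici 0 by norm_num) zero_lt_one
  simpa using this

/-- **Linear growth along rays**: if `f ≥ f a + δ` on the unit sphere around the minimum `a`,
then `f x ≥ f a + δ‖x - a‖ - δ` everywhere (convexity along the ray from `a` through `x`).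
[cite: BrascampLieb1976, Thm 4.1 (statement: "F decreases exponentially in all directions")] -/
theorem lower_bound_of_sphere (hf : ContDiff ℝ 2 f) (hpd : ∀ x, (coordHessian f x).PosDef)
    (ha : ∀ x, f a ≤ f x) {δ : ℝ} (hδ : 0 ≤ δ) (hsph : ∀ x, ‖x - a‖ = 1 → f a + δ ≤ f x)
    (x : Fin m → ℝ) : f a + δ * ‖x - a‖ - δ ≤ f x := by
  by_cases hr : ‖x - a‖ ≤ 1
  · have := ha x
    nlinarith
  push Not at hr
  set r : ℝ := ‖x - a‖ with hrdef
  have hr0 : 0 < r := zero_lt_one.trans hr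
  set u : Fin m → ℝ := a + r⁻¹ • (x - a) with hu
  have hua : u - a = r⁻¹ • (x - a) := by simp [hu]
  have hun : ‖u - a‖ = 1 := by
    rw [hua, norm_smul, Real.norm_eq_abs, abs_of_pos (inv_pos.2 hr0), ← hrdef,
      inv_mul_cancel₀ hr0.ne']
  have hv : u - a ≠ 0 := by
    intro h0
    rw [h0, norm_zero] at hun
    exact zero_ne_one hun
  obtain ⟨-, hconv⟩ := line_facts hf hpd ha hv
  -- convexity between `t = 0` and `t = r`, evaluated at `t = 1`
  have key := hconv.2 (mem_univ (0 : ℝ)) (mem_univ r) (sub_nonneg.2 (inv_le_one_of_one_le₀ hr.le))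
    (inv_pos.2 hr0).le (by ring : (1 - r⁻¹) + r⁻¹ = 1)
  have e1 : (1 - r⁻¹) • (0 : ℝ) + r⁻¹ • r = 1 := by
    rw [smul_zero, zero_add, smul_eq_mul, inv_mul_cancel₀ hr0.ne']
  have e2 : a + r • (u - a) = x := by
    rw [hua, smul_smul, mul_inv_cancel₀ hr0.ne', one_smul, add_sub_cancel]
  have e3 : a + (1 : ℝ) • (u - a) = u := by simp
  rw [e1] at key
  simp only [zero_smul, add_zero, smul_eq_mul, e2, e3] at key
  have hfu := hsph u hun
  -- `key : f u ≤ (1 - r⁻¹) f a + r⁻¹ f x`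
  have : r * f u ≤ (r - 1) * f a + f x := by
    have := mul_le_mul_of_nonneg_left key hr0.le
    have e4 : r * ((1 - r⁻¹) * f a + r⁻¹ * f x) = (r - 1) * f a + f x := by
      field_simp
    linarith [e4]
  nlinarith

/-- **Linear lower bound.** A `C²` function on `ℝᵐ` with positive definite Hessian attaining its
minimum satisfies `f x ≥ c‖x‖ - C₀` for some `c > 0`.
[cite: BrascampLieb1976, Thm 4.1 (statement, p. 375)] -/
theorem exists_linear_lower_bound (hf : ContDiff ℝ 2 f) (hpd : ∀ x, (coordHessian f x).PosDef)
    (ha : ∀ x, f a ≤ f x) : ∃ c : ℝ, 0 < c ∧ ∃ C₀ : ℝ, ∀ x, c * ‖x‖ - C₀ ≤ f x := by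
  cases m with
  | zero =>
    refine ⟨1, zero_lt_one, -f a, fun x => ?_⟩
    have hx : x = a := Subsingleton.elim x a
    rw [hx, show ‖a‖ = 0 by simp [Subsingleton.elim a 0]]
    simp
  | succ m =>
    -- the minimum of `f` on the unit sphere around `a`
    have hne : (sphere a 1).Nonempty := by
      refine ⟨a + Pi.single 0 1, ?_⟩
      simp [Pi.norm_single]
    obtain ⟨x₁, hx₁, hmin⟩ := (isCompact_sphere a 1).exists_isMinOn hne hf.continuous.continuousOn
    set δ : ℝ := f x₁ - f a with hδ
    have hx₁a : x₁ ≠ a := by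
      intro h
      rw [h, mem_sphere, dist_self] at hx₁
      exact zero_ne_one hx₁
    have hδpos : 0 < δ := sub_pos.2 (lt_of_ne hf hpd ha hx₁a)
    have hsph : ∀ x, ‖x - a‖ = 1 → f a + δ ≤ f x := fun x hx => by
      have : f x₁ ≤ f x := hmin (show x ∈ sphere a 1 by rw [mem_sphere, dist_eq_norm]; exact hx)
      linarith
    refine ⟨δ, hδpos, δ * ‖a‖ + δ - f a, fun x => ?_⟩
    have h1 := lower_bound_of_sphere hf hpd ha hδpos.le hsph x
    have h2 : ‖x‖ ≤ ‖x - a‖ + ‖a‖ := norm_le_norm_sub_add x a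
    nlinarith

/-- **`∫ e^{-f} < ∞`** for a `C²` potential with positive definite Hessian attaining its minimum
(the first assertion of Theorem 4.1). [cite: BrascampLieb1976, Thm 4.1] -/
theorem integrable_exp_neg_of_posDef (hf : ContDiff ℝ 2 f) (hpd : ∀ x, (coordHessian f x).PosDef)
    (ha : ∀ x, f a ≤ f x) : Integrable fun x => Real.exp (-f x) := by
  obtain ⟨c, hc, C₀, hcoer⟩ := exists_linear_lower_bound hf hpd ha
  exact integrable_exp_neg hf.continuous hc hcoer

/-- The extended integral `∫⁻ e^{-f}` is finite. [cite: BrascampLieb1976, Thm 4.1] -/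
theorem lintegral_exp_neg_lt_top (hf : ContDiff ℝ 2 f) (hpd : ∀ x, (coordHessian f x).PosDef)
    (ha : ∀ x, f a ≤ f x) : ∫⁻ x, ENNReal.ofReal (Real.exp (-f x)) < ∞ := by
  have := (integrable_exp_neg_of_posDef hf hpd ha).2
  simpa [hasFiniteIntegral_iff_enorm, Real.enorm_eq_ofReal (Real.exp_pos _).le] using this

end BrascampLiebConvex

end Literature.Probability.Distributions
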